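/-
COR-CM (cell pub-hodgecm2, stage 2 of the Hodge ladder) — count-neutral KERNEL COMBINATORICS «dicyclic twist: places and flips along a dicyclic datum»
(seat prover-pub-hodgecm2-b23-g42-0, binder prover b23, gen 42; claim DICYCLIC-COLUMN, HOME/INBOX.md l.10328).
Theorems only, on top of `Census/DicyclicTwistDictionary.lean`; no `decide` table, no certificate, no named fact, no `sorry`; `Interfaces.lean` (C1), every
E term, B01, `Transposition/*`, `PortJoin/*` untouched.
HONEST FRAMING: `HC_CM` is NOT proved, here or anywhere in the tree; nothing here is a period, a count of record or a headline.
T5: n/a-class (hypothesis binders: the dicyclic datum, `c * c = 1`, and in §2 an injective `ι`, `x ∉ ι(ℤ/2 × A)`, `|G| = 4|A|`); checker: self, 2026-08-23.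
-/
import Summits.HodgeConjecture.CorCM.Census.DicyclicTwistDictionary

/-!
# The dicyclic twist, dictionary II: places and flips; the datum from a cardinality count

Continuation of `Census/DicyclicTwistDictionary.lean` (the bijection `typeEquiv D : CMF G c ≃ Ty₂ A` along a dicyclic datum `D` on `(G, c)` over `A`).
* §1 **places and flips**: the place `{ι a, c·ι a}` of `G` flips the `0`-label at `a.2` and fixes the `1`-label, the place `{x·ι a, c·x·ι a}` flips
  the `1`-label at `a.2` and fixes the `0`-label (`ty_oflipCM_ι`, `ty_oflipCM_xι`, `oflipCM_ι_typeOf`, `oflipCM_xι_typeOf`); the place relations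
  `ι b ∈ {ι a, c·ι a} ↔ b.2 = a.2`, `x·ι b ∉ {ι a, c·ι a}`, … — so an abstract rank-four face of `(G, c)` is, in the model, a `0`-coordinate square,
  a `1`-coordinate square or a mixed square (part `Census/DicyclicTwistTransport.lean`);
* §2 **exhaustion from counting** (`exhaust_of_card`): an injective multiplicative-to-additive `ι : ℤ/2 × A → G` and `x ∉ ι(ℤ/2 × A)` with
  `|G| = 4|A|` give the exhaustion field of a datum — the form in which a Galois group is recognised as dicyclic.
All [folklore].

## References
* [Pohlmann1968] H. Pohlmann, Algebraic cycles on abelian varieties of complex multiplication type, Ann. of Math. 88 (1968), Thm 1.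
-/

namespace Summit.HodgeConjecture.CorCM.Census.DicyclicTwist

open Finset
open Summit.HodgeConjecture.CorCM.Prior.AllgGroup.RfwfAllgGroup
open Summit.HodgeConjecture.CorCM.Census.BlockParity
open Summit.HodgeConjecture.CorCM.Census.OddSliceFacesModel

noncomputable section

variable {G : Type*} [Group G] [Fintype G] [DecidableEq G] {c : G}
variable {A : Type} [AddCommGroup A] [Fintype A] [DecidableEq A]
variable (D : Datum G c A)

/-- Two elements of `ℤ/2` that vanish together are equal. [folklore] -/
private theorem zmod2_eq_of_iff' : ∀ {u v : ZMod 2}, (u = 0 ↔ v = 0) → u = v := by decide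

/-! ## §1 Places and flips -/

omit [Fintype G] [Fintype A] [DecidableEq A] in
/-- **Places inside `ι`**: `ι b ∈ {ι a, c·ι a} ↔ b.2 = a.2`. [folklore] -/
theorem ι_mem_orb_ι_iff (a b : ZMod 2 × A) : D.ι b ∈ orb c (D.ι a) ↔ b.2 = a.2 := by
  obtain ⟨e, s⟩ := a
  obtain ⟨e', s'⟩ := b
  rw [mem_orb, c_mul_ι_mk, D.inj.eq_iff, D.inj.eq_iff]
  simp only [Prod.mk.injEq]
  have key : e' = e ∨ e' = e + 1 := by revert e e'; decide
  tauto

omit [Fintype G] [Fintype A] [DecidableEq A] in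
/-- `x·ι b` is not at a place of `ι`. [folklore] -/
theorem xι_not_mem_orb_ι (a b : ZMod 2 × A) : D.x * D.ι b ∉ orb c (D.ι a) := by
  rw [mem_orb, c_mul_ι]
  rintro (h | h)
  · exact ι_ne_xι D a b h.symm
  · exact ι_ne_xι D _ b h.symm

omit [Fintype G] [Fintype A] [DecidableEq A] in
/-- `ι b` is not at a place of `x·ι`. [folklore] -/
theorem ι_not_mem_orb_xι (a b : ZMod 2 × A) : D.ι b ∉ orb c (D.x * D.ι a) := by
  rw [mem_orb, ← mul_assoc, ← x_mul_c, mul_assoc, c_mul_ι]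
  rintro (h | h)
  · exact ι_ne_xι D b a h
  · exact ι_ne_xι D b _ h

omit [Fintype G] [Fintype A] [DecidableEq A] in
/-- **Places inside `x·ι`**: `x·ι b ∈ {x·ι a, c·x·ι a} ↔ b.2 = a.2`. [folklore] -/
theorem xι_mem_orb_xι_iff (a b : ZMod 2 × A) : D.x * D.ι b ∈ orb c (D.x * D.ι a) ↔ b.2 = a.2 := by
  obtain ⟨e, s⟩ := a
  obtain ⟨e', s'⟩ := b
  rw [mem_orb, ← mul_assoc, ← x_mul_c, mul_assoc, c_mul_ι_mk, (xι_injective D).eq_iff, (xι_injective D).eq_iff]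
  simp only [Prod.mk.injEq]
  have key : e' = e ∨ e' = e + 1 := by revert e e'; decide
  tauto

/-- The flip bookkeeping in `ℤ/2`: membership after a symmetric difference. [folklore] -/
private theorem flip_key : ∀ (u : ZMod 2) (P : Prop) [Decidable P],
    ((u = 0 ∧ ¬ P) ∨ (P ∧ ¬ u = 0)) ↔ u + (if P then 1 else 0) = 0 := by
  intro u P _
  by_cases hP : P
  · simp only [hP, not_true_eq_false, and_false, true_and, false_or, if_true]
    revert u; decide
  · simp only [hP, not_false_eq_true, and_true, false_and, or_false, if_false, add_zero]

omit [Fintype A] in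
/-- **A flip at a place of `ι` flips the `0`-label**: `ty (Φ ∆ {ι a, c·ι a}) = ((ty Φ).1 + δ a.2, (ty Φ).2)`. [folklore] -/
theorem ty_oflipCM_ι (hc2 : c * c = 1) (a : ZMod 2 × A) (Φ : CMF G c) :
    ty D (oflipCM c hc2 (D.ι a) Φ) = ((ty D Φ).1 + δ A a.2, (ty D Φ).2) := by
  refine Prod.ext (funext fun s => zmod2_eq_of_iff' ?_) (funext fun s => zmod2_eq_of_iff' ?_)
  · show (ty D (oflipCM c hc2 (D.ι a) Φ)).1 s = 0 ↔ (ty D Φ).1 s + δ A a.2 s = 0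
    rw [← ι_mem_iff]
    show D.ι (0, s) ∈ oflip c (D.ι a) Φ.1 ↔ _
    rw [oflip, Finset.mem_symmDiff, ι_mem_orb_ι_iff, ι_mem_iff, delta_apply]
    exact flip_key _ _
  · show (ty D (oflipCM c hc2 (D.ι a) Φ)).2 s = 0 ↔ (ty D Φ).2 s = 0
    rw [← xι_mem_iff, ← xι_mem_iff D Φ]
    show D.x * D.ι (0, s) ∈ oflip c (D.ι a) Φ.1 ↔ _
    rw [oflip, Finset.mem_symmDiff]
    have hn := xι_not_mem_orb_ι D a (0, s)
    tauto

omit [Fintype A] in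
/-- **A flip at a place of `x·ι` flips the `1`-label**: `ty (Φ ∆ {x·ι a, c·x·ι a}) = ((ty Φ).1, (ty Φ).2 + δ a.2)`. [folklore] -/
theorem ty_oflipCM_xι (hc2 : c * c = 1) (a : ZMod 2 × A) (Φ : CMF G c) :
    ty D (oflipCM c hc2 (D.x * D.ι a) Φ) = ((ty D Φ).1, (ty D Φ).2 + δ A a.2) := by
  refine Prod.ext (funext fun s => zmod2_eq_of_iff' ?_) (funext fun s => zmod2_eq_of_iff' ?_)
  · show (ty D (oflipCM c hc2 (D.x * D.ι a) Φ)).1 s = 0 ↔ (ty D Φ).1 s = 0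
    rw [← ι_mem_iff, ← ι_mem_iff D Φ]
    show D.ι (0, s) ∈ oflip c (D.x * D.ι a) Φ.1 ↔ _
    rw [oflip, Finset.mem_symmDiff]
    have hn := ι_not_mem_orb_xι D a (0, s)
    tauto
  · show (ty D (oflipCM c hc2 (D.x * D.ι a) Φ)).2 s = 0 ↔ (ty D Φ).2 s + δ A a.2 s = 0
    rw [← xι_mem_iff]
    show D.x * D.ι (0, s) ∈ oflip c (D.x * D.ι a) Φ.1 ↔ _
    rw [oflip, Finset.mem_symmDiff, xι_mem_orb_xι_iff, xι_mem_iff, delta_apply]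
    exact flip_key _ _

/-- Flips of types of labels at a place of `ι`: `(typeOf (ψ₀, ψ₁)) ∆ {ι a, c·ι a} = typeOf (ψ₀ + δ a.2, ψ₁)`. [folklore] -/
theorem oflipCM_ι_typeOf (hc2 : c * c = 1) (a : ZMod 2 × A) (ψ₀ ψ₁ : Ty A) :
    oflipCM c hc2 (D.ι a) (typeOf D (ψ₀, ψ₁)) = typeOf D (ψ₀ + δ A a.2, ψ₁) := by
  apply ty_injective D
  rw [ty_oflipCM_ι, ty_typeOf, ty_typeOf]

/-- Flips of types of labels at a place of `x·ι`: `(typeOf (ψ₀, ψ₁)) ∆ {x·ι a, c·x·ι a} = typeOf (ψ₀, ψ₁ + δ a.2)`. [folklore] -/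
theorem oflipCM_xι_typeOf (hc2 : c * c = 1) (a : ZMod 2 × A) (ψ₀ ψ₁ : Ty A) :
    oflipCM c hc2 (D.x * D.ι a) (typeOf D (ψ₀, ψ₁)) = typeOf D (ψ₀, ψ₁ + δ A a.2) := by
  apply ty_injective D
  rw [ty_oflipCM_xι, ty_typeOf, ty_typeOf]

/-! ## §2 The datum from a cardinality count -/

omit [DecidableEq G] [DecidableEq A] in
include D in
/-- **`|G| = 4|A|`** along a dicyclic datum. [folklore] -/
theorem card_eq_four_mul : Fintype.card G = 4 * Fintype.card A := by
  classical
  have hb : Function.Bijective (Sum.elim D.ι fun a => D.x * D.ι a : (ZMod 2 × A) ⊕ (ZMod 2 × A) → G) := by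
    constructor
    · rintro (a | a) (b | b) h
      · exact congrArg Sum.inl (D.inj h)
      · exact absurd (h : D.ι a = D.x * D.ι b) (ι_ne_xι D a b)
      · exact absurd (h : D.x * D.ι a = D.ι b).symm (ι_ne_xι D b a)
      · exact congrArg Sum.inr (xι_injective D (h : D.x * D.ι a = D.x * D.ι b))
    · intro g
      obtain ⟨a, rfl | rfl⟩ := D.exhaust g
      · exact ⟨Sum.inl a, rfl⟩
      · exact ⟨Sum.inr a, rfl⟩
  rw [← Fintype.card_congr (Equiv.ofBijective _ hb), Fintype.card_sum, Fintype.card_prod, ZMod.card]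
  ring

omit [DecidableEq G] [DecidableEq A] in
/-- **Exhaustion from counting**: if `ι` is injective, `x ∉ ι(ℤ/2 × A)` and `|G| = 4|A|`, the two cosets exhaust `G`. [folklore] -/
theorem exhaust_of_card (ι : ZMod 2 × A → G) (x : G) (hι : ∀ a b, ι (a + b) = ι a * ι b) (hinj : Function.Injective ι)
    (hx : ∀ a, x ≠ ι a) (hcard : Fintype.card G = 4 * Fintype.card A) : ∀ g : G, ∃ a, g = ι a ∨ g = x * ι a := by
  classical
  -- the map `(ℤ/2 × A) ⊕ (ℤ/2 × A) → G`, `inl a ↦ ι a`, `inr a ↦ x·ι a` is injective between types of the same cardinality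
  have hι0 : ι 0 = 1 := by
    have h := hι 0 0
    rw [add_zero] at h
    exact mul_left_cancel (a := ι 0) (by rw [← h, mul_one])
  set f : (ZMod 2 × A) ⊕ (ZMod 2 × A) → G := Sum.elim ι fun a => x * ι a with hf
  have hfi : Function.Injective f := by
    rintro (a | a) (b | b) h
    · exact congrArg Sum.inl (hinj h)
    · exfalso
      apply hx (a - b)
      have h' : ι a = x * ι b := h
      rw [sub_eq_add_neg, hι, h', mul_assoc, ← hι, add_neg_cancel, hι0, mul_one]
    · exfalso
      apply hx (b - a)
      have h' : x * ι a = ι b := h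
      rw [sub_eq_add_neg, hι, ← h', mul_assoc, ← hι, add_neg_cancel, hι0, mul_one]
    · exact congrArg Sum.inr (hinj (mul_left_cancel (h : x * ι a = x * ι b)))
  have hcard' : Fintype.card ((ZMod 2 × A) ⊕ (ZMod 2 × A)) = Fintype.card G := by
    rw [Fintype.card_sum, Fintype.card_prod, ZMod.card, hcard]; ring
  have hfs : Function.Surjective f := (Fintype.bijective_iff_injective_and_card f).mpr ⟨hfi, hcard'⟩ |>.2
  intro g
  obtain ⟨a | a, rfl⟩ := hfs g
  · exact ⟨a, Or.inl rfl⟩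
  · exact ⟨a, Or.inr rfl⟩

end

end Summit.HodgeConjecture.CorCM.Census.DicyclicTwist
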